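import Literature.Analysis.FluidPDE.HomSobolevRepresentedL3
import Literature.Analysis.FluidPDE.FujitaKatoLocal
import HarnessLib

/-!
# Fourier-side symbols of represented Navier–Stokes data: Hermitian symmetry and
incompressibility `ξ · û₀(ξ) = 0`

Analysis/FluidPDE support file, definitions-free. In the tree's transcription of Rusin–Šverák,
J. Funct. Anal. 260 (2011) = arXiv:0911.0500 (named facts `rusin_sverak_minimal_blowup`,
`rusin_sverak_minimal_data_compact`, `rusin_sverak_weak_limit_blowup`, and Cor. 4.2 =
`rusin_sverak_weak_limit_of_singular_points`), an initial datum is a real, weakly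
divergence-free field `u₀ : ℝ³ → ℝ³` *represented* by a Fourier-side class
`g ∈ Ḣ^{1/2}(ℝ³; ℂ³) = L²(‖ξ‖ dξ; ℂ³)` (`HomSobolev.Represents`, `MildSolutions.lean`:
`∫ 𝓕φ • u₀ = ∫ φ • g` for all Schwartz `φ`), i.e. `g = û₀` as a tempered distribution. This
file **proves** the two algebraic properties of the symbol `û₀` on which every Fourier-side
manipulation of such data rests — the frequency splitting `û₀ = φ û₀ + (1 - φ) û₀` of
Rusin–Šverák 2011, §4 p. 6 ("`a₀` can be defined in terms of the Fourier transform as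
`â₀(ξ) = û₀(ξ)φ(ξ)`", Calderón's trick, which needs `a₀` real and divergence free), the identity
`P̂ u₀ = (Id - ξ⊗ξ/|ξ|²) û₀ = û₀` for the Leray projector, and the Fourier-side Picard schemes of
Lemarié-Rieusset (2016), §8.7–8.8 (used in the tree's `FujitaKatoLocal.lean` for `L²` data):

* `HomSobolev.Represents.toLp_neg_apply_eq_conj` — **Hermitian symmetry**: `û₀(-ξ)ⱼ = conj û₀(ξ)ⱼ`
  for a.e. `ξ` (reality of `u₀`);
* `HomSobolev.Represents.sum_coord_mul_toLp_apply_eq_zero` — **incompressibility**: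
  `∑ⱼ ξⱼ û₀(ξ)ⱼ = 0` for a.e. `ξ` (weak divergence-freeness of `u₀`),

where `û₀` is the stored representative `toLp (1/2) g` of the class. These are the
`Ḣ^{1/2}`-represented (non-`L²`) versions of `fourier_neg_apply_eq_conj` and
`IsWeaklyDivFree.sum_coord_mul_fourier_apply_eq_zero` of `FujitaKatoLocal.lean` (there for the
`L²` Fourier transform of an `L²` field), with the same proofs (Grafakos, *Classical Fourier
Analysis*, Prop. 2.2.11: test against real `θ ∈ C_c^∞`, use `𝓕(θ ∘ neg) = 𝓕⁻¹θ`,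
`conj 𝓕θ = 𝓕⁻¹(conj θ)`, `𝓕(ξⱼψ) = -(2πi)⁻¹ ∂ⱼ𝓕ψ`, and the fundamental lemma of the calculus of
variations), the `L²` duality `∫ φ · 𝓕f = ∫ 𝓕φ · f` being replaced by the defining identity of
`Represents` read coefficientwise (`HomSobolev.Represents.integral_mul_toLp_apply_eq`), and the
`L²` integrability of `u₀` by `u₀ ∈ L³` (`memLp_three_of_represents_complexify`,
`HomSobolevRepresentedL3.lean`) paired with Schwartz functions in `L^{3/2}`.

Dimension `3` and `s = 1/2` throughout (the pairing bounds of `HomSobolevWeakLimits.lean` are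
proved there).

## Mathlib / tree search

Mathlib: `SchwartzMap.compCLMOfContinuousLinearEquiv`, `Real.fourierInv_eq_fourier_comp_neg`,
`integral_conj`, `integral_neg_eq_self`, `locallyIntegrable_map_homeomorph`,
`Measure.map_neg_eq_self`, `ae_eq_of_integral_contDiff_smul_eq`,
`ae_eq_zero_of_integral_contDiff_smul_eq_zero`, `SchwartzMap.lineDerivOp_fourier_eq` (through
the tree's `fourier_coord_mul`). Tree: `conj_fourier_schwartz`, `fourier_coord_mul`,
`IsWeaklyDivFree.integral_fderiv_apply_eq_zero` (`FujitaKatoLocal.lean`, `WeakGradientIBP.lean`),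
`HomSobolev.Represents.locallyIntegrable_toLp` (`KatoViscosityScaling.lean`),
`memLp_three_of_represents_complexify`, `memLp_complexify_comp` (`HomSobolevRepresentedL3.lean`,
`CriticalSpacesProofs.lean`).

## References

* W. Rusin, V. Šverák, J. Funct. Anal. 260 (2011) = arXiv:0911.0500, §4 p. 6 (Calderón
  splitting on the Fourier side).
* L. Grafakos, *Classical Fourier Analysis*, 3rd ed., Prop. 2.2.11.
* P. G. Lemarié-Rieusset, *The Navier–Stokes problem in the 21st century* (2016), §8.7 (8.8).
-/

noncomputable section

open MeasureTheory Set Function Filter Topology FourierTransform Real SchwartzMap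
open scoped ENNReal NNReal InnerProductSpace ComplexConjugate LineDeriv

namespace Literature.Analysis.FluidPDE

section Symbols
open Literature.Analysis.FunctionSpaces (HomSobolev)
open Literature.Analysis.FunctionSpaces.HomSobolev

variable {u₀ : EuclideanSpace ℝ (Fin 3) → EuclideanSpace ℝ (Fin 3)}
  {g : HomSobolev (EuclideanSpace ℝ (Fin 3)) (EuclideanSpace ℂ (Fin 3)) (1 / 2 : ℝ)}

/-- **The defining identity of `Represents`, coefficientwise**: if `g ∈ Ḣ^{1/2}(ℝ³; ℂ³)`
represents the real field `u₀` (through `complexify`), then `∫ φ(ξ) û₀(ξ)ⱼ dξ = ∫ 𝓕φ(x) u₀(x)ⱼ dx`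
for every Schwartz `φ` and every coordinate `j`, `û₀ = toLp (1/2) g` the stored representative
(project `∫ 𝓕φ • u₀ = ∫ φ • g` with the `j`-th coordinate functional). [folklore] -/
theorem _root_.Literature.Analysis.FunctionSpaces.HomSobolev.Represents.integral_mul_toLp_apply_eq
    (h : g.Represents (FunctionSpaces.EuclideanSpace.complexify ∘ u₀))
    (φ : 𝓢(EuclideanSpace ℝ (Fin 3), ℂ)) (j : Fin 3) :
    ∫ ξ, φ ξ * ((toLp (1 / 2 : ℝ) g : Lp (EuclideanSpace ℂ (Fin 3)) 2
        (FunctionSpaces.homSobolevMeasure (EuclideanSpace ℝ (Fin 3)) (1 / 2 : ℝ))) :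
          EuclideanSpace ℝ (Fin 3) → EuclideanSpace ℂ (Fin 3)) ξ j =
      ∫ x, 𝓕 (φ : EuclideanSpace ℝ (Fin 3) → ℂ) x * ((u₀ x j : ℝ) : ℂ) := by
  have hid := congrArg (fun y : EuclideanSpace ℂ (Fin 3) => y j) (h.2.2 φ)
  have h1 := (EuclideanSpace.proj (𝕜 := ℂ) j).integral_comp_comm (h.2.1 φ)
  have h2 := (EuclideanSpace.proj (𝕜 := ℂ) j).integral_comp_comm (h.1 φ)
  simp only [PiLp.proj_apply, WithLp.ofLp_smul, Pi.smul_apply, smul_eq_mul] at h1 h2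
  simp only at hid
  rw [← h1, ← h2, SchwartzMap.fourier_coe] at hid
  rw [hid.symm]
  refine integral_congr_ae (Eventually.of_forall fun x => ?_)
  simp [FunctionSpaces.EuclideanSpace.complexify_apply]

/-- Each coordinate `ξ ↦ û₀(ξ)ⱼ` of the stored representative of a representing class is locally
integrable (`Represents.locallyIntegrable_toLp` composed with the coordinate functional).
[folklore] -/
theorem _root_.Literature.Analysis.FunctionSpaces.HomSobolev.Represents.locallyIntegrable_toLp_apply
    (h : g.Represents (FunctionSpaces.EuclideanSpace.complexify ∘ u₀)) (j : Fin 3) :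
    LocallyIntegrable (fun ξ => ((toLp (1 / 2 : ℝ) g : Lp (EuclideanSpace ℂ (Fin 3)) 2
        (FunctionSpaces.homSobolevMeasure (EuclideanSpace ℝ (Fin 3)) (1 / 2 : ℝ))) :
          EuclideanSpace ℝ (Fin 3) → EuclideanSpace ℂ (Fin 3)) ξ j) volume := by
  intro x
  obtain ⟨U, hU, hint⟩ := h.locallyIntegrable_toLp x
  exact ⟨U, hU, ((EuclideanSpace.proj (𝕜 := ℂ) j).integrable_comp hint).congr
    (Eventually.of_forall fun ξ => rfl)⟩

/-- **Hermitian symmetry of the symbol of a real datum.** If `g ∈ Ḣ^{1/2}(ℝ³; ℂ³)` represents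
the real field `u₀ : ℝ³ → ℝ³` (through `complexify`), then its stored representative
`û₀ = toLp (1/2) g` satisfies `û₀(-ξ)ⱼ = conj û₀(ξ)ⱼ` for a.e. `ξ` and every `j` (Grafakos,
Prop. 2.2.11 (7)–(8) for `𝓢`; here for `Ḣ^{1/2}`-represented fields: both sides are tested
against real `θ ∈ C_c^∞` through `Represents.integral_mul_toLp_apply_eq`, the reflection
`𝓕(θ ∘ neg) = 𝓕⁻¹θ` and `conj 𝓕θ = 𝓕⁻¹(conj θ)`, then `ae_eq_of_integral_contDiff_smul_eq`).
Represented version of `fourier_neg_apply_eq_conj` (`FujitaKatoLocal.lean`, `L²` fields).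
[folklore] -/
theorem _root_.Literature.Analysis.FunctionSpaces.HomSobolev.Represents.toLp_neg_apply_eq_conj
    (h : g.Represents (FunctionSpaces.EuclideanSpace.complexify ∘ u₀)) :
    ∀ᵐ ξ : EuclideanSpace ℝ (Fin 3) ∂volume, ∀ j,
      ((toLp (1 / 2 : ℝ) g : Lp (EuclideanSpace ℂ (Fin 3)) 2
        (FunctionSpaces.homSobolevMeasure (EuclideanSpace ℝ (Fin 3)) (1 / 2 : ℝ))) :
          EuclideanSpace ℝ (Fin 3) → EuclideanSpace ℂ (Fin 3)) (-ξ) j =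
      conj (((toLp (1 / 2 : ℝ) g : Lp (EuclideanSpace ℂ (Fin 3)) 2
        (FunctionSpaces.homSobolevMeasure (EuclideanSpace ℝ (Fin 3)) (1 / 2 : ℝ))) :
          EuclideanSpace ℝ (Fin 3) → EuclideanSpace ℂ (Fin 3)) ξ j) := by
  set G : EuclideanSpace ℝ (Fin 3) → EuclideanSpace ℂ (Fin 3) :=
    ((toLp (1 / 2 : ℝ) g : Lp (EuclideanSpace ℂ (Fin 3)) 2
        (FunctionSpaces.homSobolevMeasure (EuclideanSpace ℝ (Fin 3)) (1 / 2 : ℝ))) :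
          EuclideanSpace ℝ (Fin 3) → EuclideanSpace ℂ (Fin 3)) with hG
  rw [ae_all_iff]
  intro j
  -- scalar slices
  set gj : EuclideanSpace ℝ (Fin 3) → ℂ := fun ξ => G ξ j with hgj
  set fj : EuclideanSpace ℝ (Fin 3) → ℂ := fun x => ((u₀ x j : ℝ) : ℂ) with hfj
  have hfj_real : ∀ x, conj (fj x) = fj x := fun x => by simp [hfj]
  -- duality, component `j`
  have hdual : ∀ φ : 𝓢(EuclideanSpace ℝ (Fin 3), ℂ),
      ∫ ξ, φ ξ * gj ξ = ∫ x, 𝓕 (φ : EuclideanSpace ℝ (Fin 3) → ℂ) x * fj x := fun φ =>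
    h.integral_mul_toLp_apply_eq φ j
  -- the two sides of the symmetry, tested against real smooth compactly supported functions
  have hneg_int : ∀ φ : 𝓢(EuclideanSpace ℝ (Fin 3), ℂ),
      ∫ ξ, φ ξ * gj (-ξ) = ∫ x, 𝓕⁻ (φ : EuclideanSpace ℝ (Fin 3) → ℂ) x * fj x := by
    intro φ
    set φn : 𝓢(EuclideanSpace ℝ (Fin 3), ℂ) :=
      SchwartzMap.compCLMOfContinuousLinearEquiv ℂ (ContinuousLinearEquiv.neg ℝ) φ with hφn
    have hφn_apply : ∀ ξ, φn ξ = φ (-ξ) := fun ξ => by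
      simp [hφn, SchwartzMap.compCLMOfContinuousLinearEquiv_apply]
    calc ∫ ξ, φ ξ * gj (-ξ) = ∫ ξ, φn (-ξ) * gj (-ξ) := by simp only [hφn_apply, neg_neg]
      _ = ∫ ξ, φn ξ * gj ξ := integral_neg_eq_self (fun ξ => φn ξ * gj ξ) volume
      _ = ∫ x, 𝓕 (φn : EuclideanSpace ℝ (Fin 3) → ℂ) x * fj x := hdual φn
      _ = ∫ x, 𝓕⁻ (φ : EuclideanSpace ℝ (Fin 3) → ℂ) x * fj x := by
          congr 1
          funext x
          rw [Real.fourierInv_eq_fourier_comp_neg,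
            show (fun ξ => φ (-ξ)) = (φn : EuclideanSpace ℝ (Fin 3) → ℂ) from
              funext fun ξ => (hφn_apply ξ).symm]
  have hconj_int : ∀ φ : 𝓢(EuclideanSpace ℝ (Fin 3), ℂ), (∀ ξ, conj (φ ξ) = φ ξ) →
      ∫ ξ, φ ξ * conj (gj ξ) = ∫ x, 𝓕⁻ (φ : EuclideanSpace ℝ (Fin 3) → ℂ) x * fj x := by
    intro φ hφ
    calc ∫ ξ, φ ξ * conj (gj ξ) = ∫ ξ, conj (conj (φ ξ) * gj ξ) := by
            simp only [map_mul, Complex.conj_conj]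
      _ = conj (∫ ξ, conj (φ ξ) * gj ξ) := integral_conj
      _ = conj (∫ ξ, φ ξ * gj ξ) := by simp_rw [hφ]
      _ = conj (∫ x, 𝓕 (φ : EuclideanSpace ℝ (Fin 3) → ℂ) x * fj x) := by rw [hdual φ]
      _ = ∫ x, conj (𝓕 (φ : EuclideanSpace ℝ (Fin 3) → ℂ) x * fj x) := integral_conj.symm
      _ = ∫ x, 𝓕⁻ (φ : EuclideanSpace ℝ (Fin 3) → ℂ) x * fj x := by
          refine integral_congr_ae (Eventually.of_forall fun x => ?_)
          show conj (𝓕 (φ : EuclideanSpace ℝ (Fin 3) → ℂ) x * fj x) = 𝓕⁻ (φ : EuclideanSpace ℝ (Fin 3) → ℂ) x * fj x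
          rw [map_mul, hfj_real x, conj_fourier_schwartz,
            show (fun v => conj (φ v)) = (φ : EuclideanSpace ℝ (Fin 3) → ℂ) from funext hφ]
  -- conclude with the fundamental lemma of the calculus of variations
  have hgjloc : LocallyIntegrable gj volume := h.locallyIntegrable_toLp_apply j
  have hnegloc : LocallyIntegrable (fun ξ => gj (-ξ)) volume := by
    have h1 : LocallyIntegrable gj (Measure.map (Homeomorph.neg (EuclideanSpace ℝ (Fin 3))) volume) := by
      rw [show ((Homeomorph.neg (EuclideanSpace ℝ (Fin 3)) : EuclideanSpace ℝ (Fin 3) → EuclideanSpace ℝ (Fin 3)))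
        = Neg.neg from rfl, Measure.map_neg_eq_self]
      exact hgjloc
    exact (locallyIntegrable_map_homeomorph (Homeomorph.neg (EuclideanSpace ℝ (Fin 3)))).1 h1
  have hconjloc : LocallyIntegrable (fun ξ => conj (gj ξ)) volume := by
    intro x
    obtain ⟨U, hU, hint⟩ := hgjloc x
    exact ⟨U, hU, ((Complex.conjCLE : ℂ ≃L[ℝ] ℂ).toContinuousLinearMap.integrable_comp hint).congr
      (Eventually.of_forall fun ξ => rfl)⟩
  have hae : ∀ᵐ ξ ∂volume, gj (-ξ) = conj (gj ξ) := by
    refine ae_eq_of_integral_contDiff_smul_eq hnegloc hconjloc fun θ hθ hθc => ?_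
    -- the complex test function `x ↦ θ x`
    have hθC : ContDiff ℝ (⊤ : ℕ∞) (fun x => (θ x : ℂ)) := Complex.ofRealCLM.contDiff.comp hθ
    have hθCc : HasCompactSupport (fun x => (θ x : ℂ)) := hθc.comp_left Complex.ofReal_zero
    set φ : 𝓢(EuclideanSpace ℝ (Fin 3), ℂ) := hθCc.toSchwartzMap hθC with hφ
    have hφ_apply : ∀ x, φ x = (θ x : ℂ) := fun x => rfl
    have hφreal : ∀ ξ, conj (φ ξ) = φ ξ := fun ξ => by rw [hφ_apply, Complex.conj_ofReal]
    have h1 : ∫ x, θ x • gj (-x) = ∫ x, φ x * gj (-x) := by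
      simp_rw [hφ_apply, Complex.real_smul]
    have h2 : ∫ x, θ x • conj (gj x) = ∫ x, φ x * conj (gj x) := by
      simp_rw [hφ_apply, Complex.real_smul]
    rw [h1, h2, hneg_int φ, hconj_int φ hφreal]
  filter_upwards [hae] with ξ hξ
  simpa [hgj] using hξ

/-- **Incompressibility of the symbol of a divergence-free datum.** If `g ∈ Ḣ^{1/2}(ℝ³; ℂ³)`
represents the real, weakly divergence-free field `u₀ : ℝ³ → ℝ³` (`IsWeaklyDivFree`:
`∫ ⟪u₀, ∇θ⟫ = 0` for `θ ∈ C_c^∞`), then `∑ⱼ ξⱼ û₀(ξ)ⱼ = 0` for a.e. `ξ`, `û₀ = toLp (1/2) g`: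
testing against a real `ψ ∈ C_c^∞`, `∑ⱼ ∫ (ξⱼψ) û₀ⱼ = ∑ⱼ ∫ 𝓕(ξⱼψ) u₀ⱼ = -(2πi)⁻¹ ∫ D(𝓕ψ)(u₀)`
(`Represents.integral_mul_toLp_apply_eq`, `fourier_coord_mul` = Grafakos Prop. 2.2.11 (10)),
which vanishes by the divergence-free condition applied to the Schwartz functions `Re 𝓕ψ`,
`Im 𝓕ψ` (`IsWeaklyDivFree.integral_fderiv_apply_eq_zero`, with `u₀ ∈ L³` by
`memLp_three_of_represents_complexify` and `𝓕ψ ∈ L^{3/2}`). This is the condition under which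
the Leray symbol `Id − ξ⊗ξ/|ξ|²` acts as the identity on `û₀` (Lemarié-Rieusset 2016, (8.8)),
and which makes the frequency-localised pieces `φ(ξ) û₀(ξ)` of Rusin–Šverák 2011, §4 p. 6,
divergence free. Represented version of `IsWeaklyDivFree.sum_coord_mul_fourier_apply_eq_zero`
(`FujitaKatoLocal.lean`, `L²` fields). [folklore] -/
theorem _root_.Literature.Analysis.FunctionSpaces.HomSobolev.Represents.sum_coord_mul_toLp_apply_eq_zero
    (h : g.Represents (FunctionSpaces.EuclideanSpace.complexify ∘ u₀)) (hdiv : IsWeaklyDivFree u₀) :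
    ∀ᵐ ξ : EuclideanSpace ℝ (Fin 3) ∂volume,
      ∑ j, ((ξ j : ℝ) : ℂ) * ((toLp (1 / 2 : ℝ) g : Lp (EuclideanSpace ℂ (Fin 3)) 2
        (FunctionSpaces.homSobolevMeasure (EuclideanSpace ℝ (Fin 3)) (1 / 2 : ℝ))) :
          EuclideanSpace ℝ (Fin 3) → EuclideanSpace ℂ (Fin 3)) ξ j = 0 := by
  classical
  -- the Hölder triple `(3/2, 3, 1)` (cf. `FunctionSpaces.holderTriple_threeHalves_three`, not
  -- imported here to keep the import closure small)
  haveI hHT : ENNReal.HolderTriple (3 / 2) 3 1 := by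
    refine ⟨?_⟩
    have h1 : (3 / 2 : ℝ≥0∞)⁻¹ = 2 * 3⁻¹ := by
      rw [div_eq_mul_inv, ENNReal.mul_inv (Or.inl (by norm_num)) (Or.inl (by norm_num)), inv_inv,
        mul_comm]
    rw [h1, inv_one]
    calc (2 : ℝ≥0∞) * 3⁻¹ + 3⁻¹ = (2 + 1) * 3⁻¹ := by rw [add_mul, one_mul]
      _ = 3 * 3⁻¹ := by norm_num
      _ = 1 := ENNReal.mul_inv_cancel (by norm_num) (by norm_num)
  set G : EuclideanSpace ℝ (Fin 3) → EuclideanSpace ℂ (Fin 3) :=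
    ((toLp (1 / 2 : ℝ) g : Lp (EuclideanSpace ℂ (Fin 3)) 2
        (FunctionSpaces.homSobolevMeasure (EuclideanSpace ℝ (Fin 3)) (1 / 2 : ℝ))) :
          EuclideanSpace ℝ (Fin 3) → EuclideanSpace ℂ (Fin 3)) with hG
  -- the real field is an `L³` field
  have hu₀3 : MemLp u₀ 3 volume := memLp_three_of_represents_complexify h
  have hu₀m : AEStronglyMeasurable u₀ volume := hu₀3.1
  -- the divergence symbol is locally integrable
  set D : EuclideanSpace ℝ (Fin 3) → ℂ := fun ξ => ∑ j, ((ξ j : ℝ) : ℂ) * G ξ j with hD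
  have hDloc : LocallyIntegrable D volume := by
    refine locallyIntegrable_finsetSum _ fun j _ => ?_
    have h1 : LocallyIntegrable (fun ξ => G ξ j) volume := h.locallyIntegrable_toLp_apply j
    have h2 : Continuous fun ξ : EuclideanSpace ℝ (Fin 3) => ((ξ j : ℝ) : ℂ) :=
      Complex.continuous_ofReal.comp (PiLp.continuous_apply 2 _ j)
    have := (h1.locallyIntegrableOn univ).continuousOn_mul h2.continuousOn
      isOpen_univ.isLocallyClosed
    exact (locallyIntegrableOn_univ.1 this)
  refine ae_eq_zero_of_integral_contDiff_smul_eq_zero hDloc fun ψ hψ hψc => ?_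
  -- the complex test function and its coordinate multiples
  have hψC : ContDiff ℝ (⊤ : ℕ∞) (fun ξ => (ψ ξ : ℂ)) := Complex.ofRealCLM.contDiff.comp hψ
  have hψCc : HasCompactSupport (fun ξ => (ψ ξ : ℂ)) := hψc.comp_left Complex.ofReal_zero
  set Ψ : 𝓢(EuclideanSpace ℝ (Fin 3), ℂ) := hψCc.toSchwartzMap hψC with hΨ
  have hΨ_apply : ∀ ξ, Ψ ξ = (ψ ξ : ℂ) := fun ξ => rfl
  have hφC : ∀ j, ContDiff ℝ (⊤ : ℕ∞) (fun ξ : EuclideanSpace ℝ (Fin 3) => ((ξ j : ℝ) : ℂ) * Ψ ξ) :=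
    fun j => ((Complex.ofRealCLM.contDiff.comp
      ((EuclideanSpace.proj (𝕜 := ℝ) j).contDiff)).mul (Ψ.smooth ⊤))
  have hφCc : ∀ j, HasCompactSupport (fun ξ : EuclideanSpace ℝ (Fin 3) => ((ξ j : ℝ) : ℂ) * Ψ ξ) :=
    fun j => hψCc.mul_left
  set φ : Fin 3 → 𝓢(EuclideanSpace ℝ (Fin 3), ℂ) := fun j => (hφCc j).toSchwartzMap (hφC j) with hφ
  have hφ_apply : ∀ j ξ, φ j ξ = ((ξ j : ℝ) : ℂ) * Ψ ξ := fun j ξ => rfl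
  -- Step 1: `∫ ψ • D = ∑ⱼ ∫ φⱼ Gⱼ`
  have hint : ∀ j, Integrable (fun ξ => φ j ξ * G ξ j) volume := fun j =>
    ((EuclideanSpace.proj (𝕜 := ℂ) j).integrable_comp (h.2.1 (φ j))).congr
      (Eventually.of_forall fun ξ => rfl)
  have step1 : ∫ ξ, ψ ξ • D ξ = ∑ j, ∫ ξ, φ j ξ * G ξ j := by
    rw [← integral_finsetSum _ fun j _ => hint j]
    refine integral_congr_ae (Eventually.of_forall fun ξ => ?_)
    simp only [hD, hφ_apply, hΨ_apply, Complex.real_smul, Finset.mul_sum]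
    refine Finset.sum_congr rfl fun j _ => by ring
  -- Step 2: duality and the derivative of `Θ = 𝓕 Ψ`
  set Θ : 𝓢(EuclideanSpace ℝ (Fin 3), ℂ) := 𝓕 Ψ with hΘ
  have hΘcoe : (Θ : EuclideanSpace ℝ (Fin 3) → ℂ) = 𝓕 (Ψ : EuclideanSpace ℝ (Fin 3) → ℂ) := fourier_coe Ψ
  have hΘd : Differentiable ℝ (Θ : EuclideanSpace ℝ (Fin 3) → ℂ) := Θ.differentiable
  set c : ℂ := -(2 * π * Complex.I) with hcdef
  have step2 : ∀ j, ∫ ξ, φ j ξ * G ξ j =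
      c⁻¹ * ∫ x, fderiv ℝ (Θ : EuclideanSpace ℝ (Fin 3) → ℂ) x (EuclideanSpace.single j 1) *
        ((u₀ x j : ℝ) : ℂ) := by
    intro j
    rw [hG, h.integral_mul_toLp_apply_eq (φ j) j, ← integral_const_mul]
    refine integral_congr_ae (Eventually.of_forall fun x => ?_)
    have h1 : 𝓕 (φ j : EuclideanSpace ℝ (Fin 3) → ℂ) x =
        c⁻¹ * fderiv ℝ (Θ : EuclideanSpace ℝ (Fin 3) → ℂ) x (EuclideanSpace.single j 1) := by
      rw [show ((φ j : 𝓢(EuclideanSpace ℝ (Fin 3), ℂ)) : EuclideanSpace ℝ (Fin 3) → ℂ) =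
          fun ξ => ((ξ j : ℝ) : ℂ) * Ψ ξ from funext (hφ_apply j), fourier_coord_mul Ψ j x, hΘcoe]
    show 𝓕 (φ j : EuclideanSpace ℝ (Fin 3) → ℂ) x * ((u₀ x j : ℝ) : ℂ) = _
    rw [h1, mul_assoc]
  -- Step 3: sum over `j`: `∑ⱼ ∂ⱼΘ · u₀ⱼ = DΘ(u₀)`
  have hu₀j : ∀ j, MemLp (fun x => ((u₀ x j : ℝ) : ℂ)) 3 volume := fun j => by
    have := (EuclideanSpace.proj (𝕜 := ℂ) j).comp_memLp' (memLp_complexify_comp hu₀3)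
    simpa [Function.comp_def, FunctionSpaces.EuclideanSpace.complexify_apply] using this
  have hintj : ∀ j, Integrable (fun x => fderiv ℝ (Θ : EuclideanSpace ℝ (Fin 3) → ℂ) x
      (EuclideanSpace.single j 1) * ((u₀ x j : ℝ) : ℂ)) volume := fun j => by
    have h1 : MemLp (fun x => fderiv ℝ (Θ : EuclideanSpace ℝ (Fin 3) → ℂ) x
        (EuclideanSpace.single j 1)) (3 / 2) volume :=
      (∂_{EuclideanSpace.single j (1 : ℝ)} Θ).memLp (3 / 2) volume
    exact h1.integrable_mul (hu₀j j)
  have hlin : ∀ x, fderiv ℝ (Θ : EuclideanSpace ℝ (Fin 3) → ℂ) x (u₀ x) =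
      ∑ j, fderiv ℝ (Θ : EuclideanSpace ℝ (Fin 3) → ℂ) x (EuclideanSpace.single j 1) *
        ((u₀ x j : ℝ) : ℂ) := by
    intro x
    have hexp : u₀ x = ∑ j, (u₀ x j) • EuclideanSpace.single j (1 : ℝ) := by
      simpa using ((EuclideanSpace.basisFun (Fin 3) ℝ).sum_repr (u₀ x)).symm
    conv_lhs => rw [hexp]
    rw [map_sum]
    refine Finset.sum_congr rfl fun j _ => ?_
    rw [map_smul, Complex.real_smul, mul_comm]
  have hintD : Integrable (fun x => fderiv ℝ (Θ : EuclideanSpace ℝ (Fin 3) → ℂ) x (u₀ x)) volume := by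
    simp_rw [hlin]
    exact integrable_finsetSum _ fun j _ => hintj j
  have step3 : ∑ j, ∫ ξ, φ j ξ * G ξ j =
      c⁻¹ * ∫ x, fderiv ℝ (Θ : EuclideanSpace ℝ (Fin 3) → ℂ) x (u₀ x) := by
    simp_rw [step2, ← Finset.mul_sum, hlin]
    rw [integral_finsetSum _ fun j _ => hintj j]
  -- Step 4: `∫ DΘ(u₀) = 0` from the weak divergence-free condition, real and imaginary parts
  set θ₁ : EuclideanSpace ℝ (Fin 3) → ℝ := fun x => (Θ x).re with hθ₁
  set θ₂ : EuclideanSpace ℝ (Fin 3) → ℝ := fun x => (Θ x).im with hθ₂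
  have hθ₁s : ContDiff ℝ (⊤ : ℕ∞) θ₁ := Complex.reCLM.contDiff.comp (Θ.smooth ⊤)
  have hθ₂s : ContDiff ℝ (⊤ : ℕ∞) θ₂ := Complex.imCLM.contDiff.comp (Θ.smooth ⊤)
  have hD₁ : ∀ x m, fderiv ℝ θ₁ x m = (fderiv ℝ (Θ : EuclideanSpace ℝ (Fin 3) → ℂ) x m).re := by
    intro x m
    have h := (Complex.reCLM.hasFDerivAt.comp x (hΘd x).hasFDerivAt).fderiv
    rw [show θ₁ = (Complex.reCLM : ℂ → ℝ) ∘ (Θ : EuclideanSpace ℝ (Fin 3) → ℂ) from rfl, h]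
    rfl
  have hD₂ : ∀ x m, fderiv ℝ θ₂ x m = (fderiv ℝ (Θ : EuclideanSpace ℝ (Fin 3) → ℂ) x m).im := by
    intro x m
    have h := (Complex.imCLM.hasFDerivAt.comp x (hΘd x).hasFDerivAt).fderiv
    rw [show θ₂ = (Complex.imCLM : ℂ → ℝ) ∘ (Θ : EuclideanSpace ℝ (Fin 3) → ℂ) from rfl, h]
    rfl
  have h1₁ : Integrable (fun x => fderiv ℝ θ₁ x (u₀ x)) volume := by
    simp_rw [hD₁]; exact hintD.re
  have h1₂ : Integrable (fun x => fderiv ℝ θ₂ x (u₀ x)) volume := by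
    simp_rw [hD₂]; exact hintD.im
  have hnorm : Integrable (fun x => ‖(Θ : EuclideanSpace ℝ (Fin 3) → ℂ) x‖ * ‖u₀ x‖) volume :=
    (Θ.memLp (3 / 2) volume).norm.integrable_mul hu₀3.norm
  have h2₁ : Integrable (fun x => θ₁ x • u₀ x) volume := by
    refine hnorm.mono' ((Complex.continuous_re.comp Θ.continuous).aestronglyMeasurable.smul hu₀m)
      (Eventually.of_forall fun x => ?_)
    rw [norm_smul]
    gcongr
    exact Complex.abs_re_le_norm _
  have h2₂ : Integrable (fun x => θ₂ x • u₀ x) volume := by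
    refine hnorm.mono' ((Complex.continuous_im.comp Θ.continuous).aestronglyMeasurable.smul hu₀m)
      (Eventually.of_forall fun x => ?_)
    rw [norm_smul]
    gcongr
    exact Complex.abs_im_le_norm _
  have hI₁ : ∫ x, fderiv ℝ θ₁ x (u₀ x) = 0 := hdiv.integral_fderiv_apply_eq_zero hu₀m hθ₁s h1₁ h2₁
  have hI₂ : ∫ x, fderiv ℝ θ₂ x (u₀ x) = 0 := hdiv.integral_fderiv_apply_eq_zero hu₀m hθ₂s h1₂ h2₂
  have step4 : ∫ x, fderiv ℝ (Θ : EuclideanSpace ℝ (Fin 3) → ℂ) x (u₀ x) = 0 := by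
    have hsplit : ∀ x, fderiv ℝ (Θ : EuclideanSpace ℝ (Fin 3) → ℂ) x (u₀ x) =
        ((fderiv ℝ θ₁ x (u₀ x) : ℝ) : ℂ) + ((fderiv ℝ θ₂ x (u₀ x) : ℝ) : ℂ) * Complex.I := by
      intro x
      rw [hD₁, hD₂, Complex.re_add_im]
    simp_rw [hsplit]
    rw [integral_add h1₁.ofReal (h1₂.ofReal.mul_const _), integral_mul_const, integral_complex_ofReal,
      integral_complex_ofReal, hI₁, hI₂]
    simp
  rw [step1, step3, step4, mul_zero]

end Symbols

end Literature.Analysis.FluidPDE
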